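import Literature.AlgebraicTopology.SingularHomology.TripleSequence
import Literature.AlgebraicTopology.SingularHomology.UniverseTransportIso
import Mathlib.Algebra.Homology.EulerCharacteristic
import Mathlib.LinearAlgebra.Dimension.RankNullity
import Mathlib.LinearAlgebra.FreeModule.StrongRankCondition
import Mathlib.RingTheory.Noetherian.Basic
import Mathlib.Algebra.Homology.HomologicalComplexLimits
import HarnessLib

/-!
# Euler characteristics along the long exact sequence of a triple

Pure bookkeeping for relative singular homology (A. Hatcher, *Algebraic Topology* (2002), §2.1,
p. 118, the long exact sequence of the triple `B ⊆ A ⊆ X`; §2.2, p. 146–147, Thm. 2.44 and its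
proof: "the alternating sum of ranks is additive along exact sequences of finitely generated
groups"; E. H. Spanier, *Algebraic Topology* (1966), Ch. 4 §3, Thm. 14 and Ex. B: the Euler
characteristic `χ(X, A) = Σ (-1)^q rank H_q(X, A)` is defined when the graded homology is finitely
generated and bounded, and `χ(X, B) = χ(A, B) + χ(X, A)` for a triple).

* `Literature.AlgebraicTopology.SingularHomology.GradedLES` — the shape of a long exact sequence
  `⋯ ⟶ A k ⟶ B k ⟶ C k ⟶ A (k - 1) ⟶ ⋯ ⟶ B 0 ⟶ C 0 ⟶ 0` of `R`-modules, and
  `GradedLES.ofTriple` — the long exact sequence of a triple of spaces (`TripleSequence.lean`);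
* `GradedLES.eulerSum_rel` — **additivity of the truncated Euler characteristic**
  `χ_N(A) - χ_N(B) + χ_N(C) = 0` whenever the terms below `N` are finitely generated and
  `C N = 0` (rank–nullity over a ring satisfying `HasRankNullity`, e.g. `ℤ` or a field);
* `relEuler R M X A = χ(X, A) = Σₖ (-1)^k rank_R H_k(X, A; M)` — the relative Euler
  characteristic, DEFINED AS Mathlib's `GradedObject.eulerChar (ComplexShape.down ℕ)`
  (`Mathlib.Algebra.Homology.EulerCharacteristic`: `∑ᶠ k, (-1)^k rank (V k)`, the `N`-free
  canonical notion, equal to `HomologicalComplex.homologyEulerChar` of the relative singular chain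
  complex) of the graded module `k ↦ H_k(X, A; M)`; `FinRelHomology R M X A N` — "`H_k(X, A; M)`
  is finitely generated for all `k` and vanishes for `k ≥ N`", under which `relEuler` is the
  finite truncated sum `eulerSum` (`FinRelHomology.relEuler_eq_eulerSum`, the bridge between
  Mathlib's `finsum` and the truncated device used along exact sequences); invariance under
  degreewise isomorphisms and under homeomorphisms of pairs in possibly different universes
  (`…UniverseTransportIso`); and the three **two-out-of-three** statements for a triple
  `B ⊆ A ⊆ X` with the uniform identity `χ(X, B) = χ(A, B) + χ(X, A)`
  (`FinRelHomology.triple_mid/left/right`).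

Everything here is proved; nothing of the tree is restated; the only new notion is the bounded
finiteness predicate `FinRelHomology` (the Euler characteristic itself is Mathlib's).

## References

* A. Hatcher, *Algebraic Topology*, CUP 2002, §2.1 p. 118 (exact sequence of a triple), §2.2
  pp. 146–147, Thm. 2.44. [HatcherAT2002]
* E. H. Spanier, *Algebraic Topology*, Springer 1981, Ch. 4 §3 (Euler characteristic). [Spanier1981]
-/

noncomputable section

open CategoryTheory Limits Finset

universe u u' v w

namespace Literature.AlgebraicTopology.SingularHomology

/-! ### Algebra: exactness in `ModuleCat R` -/

section Algebra

variable {R : Type v} [CommRing R]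

/-- A zero object of `ModuleCat R` is a finitely generated module. [folklore] -/
theorem finite_of_isZero {X : ModuleCat.{w} R} (hX : IsZero X) : Module.Finite R X := by
  haveI := ModuleCat.subsingleton_of_isZero hX
  infer_instance

/-- A zero object of `ModuleCat R` has rank `0`. [folklore] -/
theorem finrank_eq_zero_of_isZero [Nontrivial R] {X : ModuleCat.{w} R} (hX : IsZero X) :
    Module.finrank R X = 0 := by
  haveI := ModuleCat.subsingleton_of_isZero hX
  exact Module.finrank_zero_of_subsingleton

/-- In an exact sequence `X₁ ⟶ X₂ ⟶ X₃` of modules over a Noetherian ring, if `X₁` and `X₃`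
are finitely generated then so is `X₂` (Hatcher 2002, proof of Lemma 2.34 (c) / standard).
[folklore] -/
theorem _root_.CategoryTheory.ShortComplex.Exact.moduleCat_finite_X₂ [IsNoetherianRing R]
    {S : ShortComplex (ModuleCat.{w} R)} (hS : S.Exact) [Module.Finite R S.X₁]
    [Module.Finite R S.X₃] : Module.Finite R S.X₂ := by
  haveI : IsNoetherian R S.X₂ :=
    isNoetherian_of_range_eq_ker S.f.hom S.g.hom hS.moduleCat_range_eq_ker
  exact Module.IsNoetherian.finite R _

/-- **Rank–nullity along an exact sequence**: for `X₁ ⟶ X₂ ⟶ X₃` exact at `X₂` with `X₂`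
finitely generated, `rank X₂ = rank (im f) + rank (im g)`. [folklore] -/
theorem _root_.CategoryTheory.ShortComplex.Exact.finrank_X₂_eq [HasRankNullity.{w} R]
    {S : ShortComplex (ModuleCat.{w} R)} (hS : S.Exact) [Module.Finite R S.X₂] :
    Module.finrank R S.X₂ =
      Module.finrank R (LinearMap.range S.f.hom) + Module.finrank R (LinearMap.range S.g.hom) := by
  haveI : Nontrivial R := nontrivial_of_hasRankNullity.{w} R
  have h1 := Submodule.finrank_quotient_add_finrank (LinearMap.ker S.g.hom)
  rw [LinearEquiv.finrank_eq S.g.hom.quotKerEquivRange, ← hS.moduleCat_range_eq_ker] at h1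
  omega

/-- The image of an epimorphism of modules has the rank of the target. [folklore] -/
theorem finrank_range_of_epi [HasRankNullity.{w} R] {X Y : ModuleCat.{w} R} (f : X ⟶ Y) [Epi f] :
    Module.finrank R (LinearMap.range f.hom) = Module.finrank R Y := by
  rw [LinearMap.range_eq_top.2 ((ModuleCat.epi_iff_surjective f).1 inferInstance), finrank_top]

/-- The image of a morphism into a zero object has rank `0`. [folklore] -/
theorem finrank_range_of_isZero_target [Nontrivial R] {X Y : ModuleCat.{w} R} (f : X ⟶ Y)
    (hY : IsZero Y) : Module.finrank R (LinearMap.range f.hom) = 0 := by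
  haveI := ModuleCat.subsingleton_of_isZero hY
  exact Module.finrank_zero_of_subsingleton

/-- The image of a morphism out of a zero object has rank `0`. [folklore] -/
theorem finrank_range_of_isZero_source [Nontrivial R] {X Y : ModuleCat.{w} R} (f : X ⟶ Y)
    (hX : IsZero X) : Module.finrank R (LinearMap.range f.hom) = 0 := by
  haveI := ModuleCat.subsingleton_of_isZero hX
  have hr : LinearMap.range f.hom = ⊥ := by
    rw [LinearMap.range_eq_bot]
    ext x
    rw [Subsingleton.elim x 0, map_zero, LinearMap.zero_apply]
  rw [hr, finrank_bot]

end Algebra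

/-! ### The truncated Euler characteristic of a graded module -/

section EulerSum

variable (R : Type v) [CommRing R]

/-- The Euler characteristic of the graded module `V`, **truncated** below degree `N`:
`χ_N(V) = Σ_{k<N} (-1)^k rank_R (V k)` (Hatcher 2002, §2.2, p. 146) — the internal device for
the bookkeeping along long exact sequences; the exported, `N`-free notion is Mathlib's
`GradedObject.eulerChar (ComplexShape.down ℕ) V = ∑ᶠ k, (-1)^k rank (V k)`, to which it is equal
as soon as `V` vanishes from degree `N` on (`eulerChar_eq_eulerSum`). [cite: HatcherAT2002, §2.2, p. 146 (Euler characteristic)] -/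
def eulerSum (V : ℕ → ModuleCat.{w} R) (N : ℕ) : ℤ :=
  ∑ k ∈ Finset.range N, (-1 : ℤ) ^ k * (Module.finrank R (V k) : ℤ)

variable {R}

/-- Unfolding of `eulerSum`. [folklore] -/
theorem eulerSum_def (V : ℕ → ModuleCat.{w} R) (N : ℕ) :
    eulerSum R V N = ∑ k ∈ Finset.range N, (-1 : ℤ) ^ k * (Module.finrank R (V k) : ℤ) :=
  rfl

/-- Beyond the vanishing range the truncated Euler characteristic is constant. [folklore] -/
theorem eulerSum_eq_of_le [Nontrivial R] {V : ℕ → ModuleCat.{w} R} {N L : ℕ} (hNL : N ≤ L)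
    (hV : ∀ k, N ≤ k → IsZero (V k)) : eulerSum R V L = eulerSum R V N := by
  obtain ⟨m, rfl⟩ := Nat.exists_eq_add_of_le hNL
  rw [eulerSum, eulerSum, Finset.sum_range_add]
  refine add_eq_left.2 (Finset.sum_eq_zero fun k _ => ?_)
  rw [finrank_eq_zero_of_isZero (hV (N + k) (Nat.le_add_right N k)), Nat.cast_zero, mul_zero]

/-- Degreewise isomorphic graded modules have the same truncated Euler characteristic.
[folklore] -/
theorem eulerSum_congr {V W : ℕ → ModuleCat.{w} R} {N : ℕ} (e : ∀ k, k < N → (V k ≅ W k)) :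
    eulerSum R V N = eulerSum R W N := by
  refine Finset.sum_congr rfl fun k hk => ?_
  rw [LinearEquiv.finrank_eq (e k (Finset.mem_range.1 hk)).toLinearEquiv]

end EulerSum

/-! ### Long exact sequences of graded modules and the additivity of `χ` -/

/-- The shape of a **long exact sequence** of `R`-modules indexed by `ℕ`,
`⋯ ⟶ C (k+1) ⟶ A k ⟶ B k ⟶ C k ⟶ A (k-1) ⟶ ⋯ ⟶ A 0 ⟶ B 0 ⟶ C 0 ⟶ 0`: three graded objects
with maps `i`, `j`, `d`, exact at every spot, and `j 0` onto (Hatcher 2002, §2.1, p. 118: the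
long exact sequence of a triple has this shape). [cite: HatcherAT2002, §2.1, p. 118] -/
structure GradedLES (R : Type v) [CommRing R] where
  /-- The first graded object (`H_•(A, B)` for a triple). -/
  A : ℕ → ModuleCat.{w} R
  /-- The second graded object (`H_•(X, B)` for a triple). -/
  B : ℕ → ModuleCat.{w} R
  /-- The third graded object (`H_•(X, A)` for a triple). -/
  C : ℕ → ModuleCat.{w} R
  /-- `i : A k ⟶ B k`. -/
  i : ∀ k, A k ⟶ B k
  /-- `j : B k ⟶ C k`. -/
  j : ∀ k, B k ⟶ C k
  /-- The connecting map `d : C (k + 1) ⟶ A k`. -/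
  d : ∀ k, C (k + 1) ⟶ A k
  /-- `d ≫ i = 0`. -/
  d_i : ∀ k, d k ≫ i k = 0
  /-- `i ≫ j = 0`. -/
  i_j : ∀ k, i k ≫ j k = 0
  /-- `j ≫ d = 0`. -/
  j_d : ∀ k, j (k + 1) ≫ d k = 0
  /-- Exactness at `A k`. -/
  exact₁ : ∀ k, (ShortComplex.mk _ _ (d_i k)).Exact
  /-- Exactness at `B k`. -/
  exact₂ : ∀ k, (ShortComplex.mk _ _ (i_j k)).Exact
  /-- Exactness at `C (k + 1)`. -/
  exact₃ : ∀ k, (ShortComplex.mk _ _ (j_d k)).Exact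
  /-- The sequence ends with `B 0 ⟶ C 0 ⟶ 0`. -/
  epi_j_zero : Epi (j 0)

namespace GradedLES

variable {R : Type v} [CommRing R] (L : GradedLES.{v, w} R)

/-- `B k` is finitely generated if `A k` and `C k` are (Noetherian ring). [folklore] -/
theorem finite_B [IsNoetherianRing R] (k : ℕ) (hA : Module.Finite R (L.A k))
    (hC : Module.Finite R (L.C k)) : Module.Finite R (L.B k) :=
  (L.exact₂ k).moduleCat_finite_X₂

/-- `A k` is finitely generated if `C (k + 1)` and `B k` are (Noetherian ring). [folklore] -/
theorem finite_A [IsNoetherianRing R] (k : ℕ) (hC : Module.Finite R (L.C (k + 1)))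
    (hB : Module.Finite R (L.B k)) : Module.Finite R (L.A k) :=
  (L.exact₁ k).moduleCat_finite_X₂

/-- `C (k + 1)` is finitely generated if `B (k + 1)` and `A k` are (Noetherian ring). [folklore] -/
theorem finite_C_succ [IsNoetherianRing R] (k : ℕ) (hB : Module.Finite R (L.B (k + 1)))
    (hA : Module.Finite R (L.A k)) : Module.Finite R (L.C (k + 1)) :=
  (L.exact₃ k).moduleCat_finite_X₂

/-- `C 0` is finitely generated if `B 0` is (it is a quotient of it). [folklore] -/
theorem finite_C_zero (hB : Module.Finite R (L.B 0)) : Module.Finite R (L.C 0) :=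
  haveI := L.epi_j_zero
  Module.Finite.of_surjective (L.j 0).hom ((ModuleCat.epi_iff_surjective _).1 inferInstance)

/-- `B k = 0` if `A k = 0` and `C k = 0`. [folklore] -/
theorem isZero_B (k : ℕ) (hA : IsZero (L.A k)) (hC : IsZero (L.C k)) : IsZero (L.B k) :=
  (L.exact₂ k).isZero_of_both_zeros (hA.eq_of_src _ _) (hC.eq_of_tgt _ _)

/-- `A k = 0` if `C (k + 1) = 0` and `B k = 0`. [folklore] -/
theorem isZero_A (k : ℕ) (hC : IsZero (L.C (k + 1))) (hB : IsZero (L.B k)) : IsZero (L.A k) :=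
  (L.exact₁ k).isZero_of_both_zeros (hC.eq_of_src _ _) (hB.eq_of_tgt _ _)

/-- `C (k + 1) = 0` if `B (k + 1) = 0` and `A k = 0`. [folklore] -/
theorem isZero_C_succ (k : ℕ) (hB : IsZero (L.B (k + 1))) (hA : IsZero (L.A k)) :
    IsZero (L.C (k + 1)) :=
  (L.exact₃ k).isZero_of_both_zeros (hB.eq_of_src _ _) (hA.eq_of_tgt _ _)

/-- `C 0 = 0` if `B 0 = 0`. [folklore] -/
theorem isZero_C_zero (hB : IsZero (L.B 0)) : IsZero (L.C 0) :=
  haveI := L.epi_j_zero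
  IsZero.of_epi_eq_zero (L.j 0) (hB.eq_of_src _ _)

section Rank

variable [HasRankNullity.{w} R]

/-- Rank of `A k`: `rank A k = rank (im d k) + rank (im i k)`. [folklore] -/
theorem finrank_A (k : ℕ) [Module.Finite R (L.A k)] :
    (Module.finrank R (L.A k) : ℤ) =
      Module.finrank R (LinearMap.range (L.d k).hom) + Module.finrank R (LinearMap.range (L.i k).hom) := by
  exact_mod_cast (L.exact₁ k).finrank_X₂_eq

/-- Rank of `B k`: `rank B k = rank (im i k) + rank (im j k)`. [folklore] -/
theorem finrank_B (k : ℕ) [Module.Finite R (L.B k)] :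
    (Module.finrank R (L.B k) : ℤ) =
      Module.finrank R (LinearMap.range (L.i k).hom) + Module.finrank R (LinearMap.range (L.j k).hom) := by
  exact_mod_cast (L.exact₂ k).finrank_X₂_eq

/-- Rank of `C (k + 1)`: `rank C (k + 1) = rank (im j (k + 1)) + rank (im d k)`. [folklore] -/
theorem finrank_C_succ (k : ℕ) [Module.Finite R (L.C (k + 1))] :
    (Module.finrank R (L.C (k + 1)) : ℤ) =
      Module.finrank R (LinearMap.range (L.j (k + 1)).hom) +
        Module.finrank R (LinearMap.range (L.d k).hom) := by
  exact_mod_cast (L.exact₃ k).finrank_X₂_eq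

/-- Rank of `C 0`: `rank C 0 = rank (im j 0)`. [folklore] -/
theorem finrank_C_zero : (Module.finrank R (L.C 0) : ℤ) = Module.finrank R (LinearMap.range (L.j 0).hom) := by
  haveI := L.epi_j_zero
  exact_mod_cast (finrank_range_of_epi (L.j 0)).symm

/-- **Additivity of the Euler characteristic along a long exact sequence** (Hatcher 2002,
§2.2, proof of Thm. 2.44; Spanier 1966, Ch. 4 §3 Thm. 14): if all terms of degree `< N` are
finitely generated and `C N = 0`, then `χ_N(A) - χ_N(B) + χ_N(C) = 0`, where
`χ_N(V) = Σ_{k<N} (-1)^k rank V k`.  Proof: by rank–nullity and exactness,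
`rank A k = rank im d k + rank im i k`, `rank B k = rank im i k + rank im j k`,
`rank C (k+1) = rank im j (k+1) + rank im d k`, `rank C 0 = rank im j 0`; the alternating sum
telescopes to `± rank im d (N-1) = 0`. [cite: HatcherAT2002, §2.2, Thm. 2.44 (proof)] -/
theorem eulerSum_rel (N : ℕ) (hA : ∀ k, k < N → Module.Finite R (L.A k))
    (hB : ∀ k, k < N → Module.Finite R (L.B k)) (hC : ∀ k, k < N → Module.Finite R (L.C k))
    (hN : IsZero (L.C N)) :
    eulerSum R L.A N - eulerSum R L.B N + eulerSum R L.C N = 0 := by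
  haveI : Nontrivial R := nontrivial_of_hasRankNullity.{w} R
  -- ranks of the images
  set rd : ℕ → ℤ := fun k => Module.finrank R (LinearMap.range (L.d k).hom) with hrd
  set rj : ℕ → ℤ := fun k => Module.finrank R (LinearMap.range (L.j k).hom) with hrj
  -- the pointwise identity `a k - b k + c k = rd k + (c k - rj k)`
  have key : ∀ k, k < N →
      (-1 : ℤ) ^ k * (Module.finrank R (L.A k) : ℤ) - (-1 : ℤ) ^ k * (Module.finrank R (L.B k) : ℤ) +
        (-1 : ℤ) ^ k * (Module.finrank R (L.C k) : ℤ) =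
      (-1 : ℤ) ^ k * rd k + (-1 : ℤ) ^ k * ((Module.finrank R (L.C k) : ℤ) - rj k) := by
    intro k hk
    haveI := hA k hk
    haveI := hB k hk
    rw [L.finrank_A k, L.finrank_B k]
    ring
  have hsum : eulerSum R L.A N - eulerSum R L.B N + eulerSum R L.C N =
      (∑ k ∈ Finset.range N, (-1 : ℤ) ^ k * rd k) +
        ∑ k ∈ Finset.range N, (-1 : ℤ) ^ k * ((Module.finrank R (L.C k) : ℤ) - rj k) := by
    rw [eulerSum, eulerSum, eulerSum, ← Finset.sum_sub_distrib, ← Finset.sum_add_distrib,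
      ← Finset.sum_add_distrib]
    exact Finset.sum_congr rfl fun k hk => key k (Finset.mem_range.1 hk)
  rw [hsum]
  -- `c 0 - rj 0 = 0`, `c (k+1) - rj (k+1) = rd k`, `rd (N - 1) = 0`
  cases N with
  | zero => simp
  | succ n =>
    have h0 : (Module.finrank R (L.C 0) : ℤ) - rj 0 = 0 := by
      rw [L.finrank_C_zero]; exact sub_self _
    have hS : ∀ k, k < n → (Module.finrank R (L.C (k + 1)) : ℤ) - rj (k + 1) = rd k := by
      intro k hk
      haveI := hC (k + 1) (by omega)
      rw [L.finrank_C_succ k]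
      ring
    have hlast : rd n = 0 := by
      show (Module.finrank R (LinearMap.range (L.d n).hom) : ℤ) = 0
      exact_mod_cast finrank_range_of_isZero_source (L.d n) hN
    rw [Finset.sum_range_succ, Finset.sum_range_succ', h0, mul_zero, add_zero, hlast, mul_zero,
      add_zero]
    have hS' : ∑ k ∈ Finset.range n, (-1 : ℤ) ^ (k + 1) *
        ((Module.finrank R (L.C (k + 1)) : ℤ) - rj (k + 1)) =
        ∑ k ∈ Finset.range n, -((-1 : ℤ) ^ k * rd k) := by
      refine Finset.sum_congr rfl fun k hk => ?_
      rw [hS k (Finset.mem_range.1 hk), pow_succ]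
      ring
    rw [hS', Finset.sum_neg_distrib]
    exact add_neg_cancel _

end Rank

end GradedLES

/-! ### The Euler characteristic of a graded object: Mathlib's `GradedObject.eulerChar` -/

section EulerChar

variable {R : Type v} [CommRing R]

/-- **Bridge to Mathlib's Euler characteristic.**  If the graded module `V` vanishes from degree
`N` on, Mathlib's `GradedObject.eulerChar (ComplexShape.down ℕ) V = ∑ᶠ k, (-1)^k rank (V k)`
(the `N`-free notion; `Mathlib.Algebra.Homology.EulerCharacteristic`) is the truncated sum
`eulerSum R V N`. [folklore] -/
theorem eulerChar_eq_eulerSum [Nontrivial R] {V : ℕ → ModuleCat.{w} R} {N : ℕ}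
    (hV : ∀ k, N ≤ k → IsZero (V k)) :
    GradedObject.eulerChar (ComplexShape.down ℕ) V = eulerSum R V N := by
  rw [GradedObject.eulerChar_eq_sum_finSet_of_finrankSupport_subset _ V (Finset.range N)]
  · -- the sign `((down ℕ).χ k : ℤ)` is `(-1) ^ k` by definition
    exact Finset.sum_congr rfl fun k _ => rfl
  · intro k hk
    by_contra h
    rw [Finset.mem_coe, Finset.mem_range, not_lt] at h
    exact hk (finrank_eq_zero_of_isZero (hV k h))

/-- Degreewise isomorphic graded modules (possibly in different universes, through linear
equivalences of the carriers) have the same Euler characteristic. [folklore] -/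
theorem eulerChar_congr_of_linearEquiv {V : ℕ → ModuleCat.{w} R} {V' : ℕ → ModuleCat.{u'} R}
    (e : ∀ k, V k ≃ₗ[R] V' k) :
    GradedObject.eulerChar (ComplexShape.down ℕ) V = GradedObject.eulerChar (ComplexShape.down ℕ) V' := by
  unfold GradedObject.eulerChar
  exact finsum_congr fun k => by rw [(e k).finrank_eq]

end EulerChar

/-! ### Pairs with finitely generated, bounded homology; the relative Euler characteristic -/

section Pairs

variable (R : Type v) [CommRing R] (M : Type v) [AddCommGroup M] [Module R M]
variable {X Y : Type u} {Y' : Type u'} [TopologicalSpace X] [TopologicalSpace Y] [TopologicalSpace Y']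

variable (X) in
/-- **`FinRelHomology R M X A N`: the relative homology `H_•(X, A; M)` is finitely generated in
every degree and vanishes in degrees `≥ N`** — the hypothesis under which the Euler
characteristic `χ(X, A) = Σ (-1)^k rank H_k(X, A)` is a finite sum (Spanier 1966, Ch. 4 §3,
before Thm. 14; Hatcher 2002, §2.2 p. 146). [cite: Spanier1981, Ch. 4 §3 (Euler characteristic)] -/
structure FinRelHomology (A : Set X) (N : ℕ) : Prop where
  /-- every `H_k(X, A; M)` is a finitely generated `R`-module -/
  finite : ∀ k, Module.Finite R (relativeSingularHomology R M X A k)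
  /-- `H_k(X, A; M) = 0` for `k ≥ N` -/
  isZero : ∀ k, N ≤ k → IsZero (relativeSingularHomology R M X A k)

variable (X) in
/-- **The relative Euler characteristic** `χ(X, A) = Σₖ (-1)^k rank_R H_k(X, A; M)` (Spanier
1966, Ch. 4 §3; Hatcher 2002, §2.2 p. 146), defined as Mathlib's Euler characteristic
`GradedObject.eulerChar (ComplexShape.down ℕ)` of the graded module `k ↦ H_k(X, A; M)` — i.e.
the homological Euler characteristic `HomologicalComplex.homologyEulerChar` of the relative
singular chain complex — a `finsum` with the junk value `0` when infinitely many ranks are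
non-zero; under `FinRelHomology R M X A N` it is the finite sum below `N`
(`FinRelHomology.relEuler_eq_sum`). [cite: Spanier1981, Ch. 4 §3 (Euler characteristic)] -/
def relEuler (A : Set X) : ℤ :=
  GradedObject.eulerChar (ComplexShape.down ℕ) (fun k => relativeSingularHomology R M X A k)

variable {R M}

/-- `relEuler` is Mathlib's homological Euler characteristic of the relative singular chain
complex. [folklore] -/
theorem relEuler_eq_homologyEulerChar (A : Set X) :
    relEuler R M X A = (relativeSingularChainComplex R M X A).homologyEulerChar :=
  rfl

/-- A constructor: finitely generated below `N` and zero from `N` on. [folklore] -/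
theorem FinRelHomology.mk' {A : Set X} {N : ℕ}
    (hfin : ∀ k, k < N → Module.Finite R (relativeSingularHomology R M X A k))
    (hzero : ∀ k, N ≤ k → IsZero (relativeSingularHomology R M X A k)) :
    FinRelHomology R M X A N :=
  ⟨fun k => (Nat.lt_or_ge k N).elim (hfin k) fun hk => finite_of_isZero (hzero k hk), hzero⟩

/-- Enlarging the bound. [folklore] -/
theorem FinRelHomology.mono {A : Set X} {N L : ℕ} (h : FinRelHomology R M X A N) (hNL : N ≤ L) :
    FinRelHomology R M X A L :=
  ⟨h.finite, fun k hk => h.isZero k (hNL.trans hk)⟩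

/-- **Under `FinRelHomology R M X A N` the Euler characteristic is the finite alternating sum of
ranks below `N`** (bridge to the truncated sums used along exact sequences). [cite: Spanier1981, Ch. 4 §3 (Euler characteristic)] -/
theorem FinRelHomology.relEuler_eq_eulerSum [Nontrivial R] {A : Set X} {N : ℕ}
    (h : FinRelHomology R M X A N) :
    relEuler R M X A = eulerSum R (fun k => relativeSingularHomology R M X A k) N :=
  eulerChar_eq_eulerSum h.isZero

/-- Under `FinRelHomology R M X A N`, `χ(X, A) = Σ_{k<N} (-1)^k rank_R H_k(X, A; M)`.
[cite: Spanier1981, Ch. 4 §3 (Euler characteristic)] -/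
theorem FinRelHomology.relEuler_eq_sum [Nontrivial R] {A : Set X} {N : ℕ}
    (h : FinRelHomology R M X A N) :
    relEuler R M X A =
      ∑ k ∈ Finset.range N, (-1 : ℤ) ^ k * (Module.finrank R (relativeSingularHomology R M X A k) : ℤ) :=
  h.relEuler_eq_eulerSum

/-- If all relative homology vanishes, `χ(X, A) = 0`. [folklore] -/
theorem relEuler_eq_zero_of_isZero [Nontrivial R] {A : Set X}
    (h : ∀ k, IsZero (relativeSingularHomology R M X A k)) : relEuler R M X A = 0 := by
  unfold relEuler
  rw [eulerChar_eq_eulerSum (R := R) (N := 0) (fun k _ => h k)]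
  simp [eulerSum]

/-- Finiteness of homology is transported along degreewise isomorphisms of relative homology
(e.g. those induced by homotopy equivalences or excisions). [folklore] -/
theorem FinRelHomology.of_iso {A : Set X} {B : Set Y} {N : ℕ}
    (e : ∀ k, relativeSingularHomology R M X A k ≅ relativeSingularHomology R M Y B k)
    (h : FinRelHomology R M X A N) : FinRelHomology R M Y B N :=
  ⟨fun k => by
    haveI := h.finite k
    exact Module.Finite.equiv (e k).toLinearEquiv,
   fun k hk => (h.isZero k hk).of_iso (e k).symm⟩

/-- The Euler characteristic is transported along degreewise isomorphisms of relative homology.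
[folklore] -/
theorem relEuler_eq_of_iso {A : Set X} {B : Set Y}
    (e : ∀ k, relativeSingularHomology R M X A k ≅ relativeSingularHomology R M Y B k) :
    relEuler R M X A = relEuler R M Y B :=
  eulerChar_congr_of_linearEquiv fun k => (e k).toLinearEquiv

/-- **Homeomorphic pairs — possibly in different universes — have the same finiteness of
homology** (functoriality of relative homology, Hatcher 2002, §2.1; across universes through the
tree's `relativeSingularHomology.xEquiv`). [cite: HatcherAT2002, §2.1 (maps of pairs, before Prop. 2.19)] -/
theorem FinRelHomology.of_homeomorph {A : Set X} {B : Set Y'} (e : X ≃ₜ Y') (he : Set.MapsTo e A B)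
    (he' : Set.MapsTo e.symm B A) {N : ℕ} (h : FinRelHomology R M X A N) :
    FinRelHomology R M Y' B N :=
  ⟨fun k => by
    haveI := h.finite k
    exact Module.Finite.equiv (relativeSingularHomology.xEquiv R M e he he' k),
   fun k hk => isZero_of_linearEquiv R (relativeSingularHomology.xEquiv R M e he he' k)
    (h.isZero k hk)⟩

/-- **Homeomorphic pairs — possibly in different universes — have the same Euler
characteristic** (functoriality of relative homology, Hatcher 2002, §2.1). [cite: HatcherAT2002, §2.1 (maps of pairs, before Prop. 2.19)] -/
theorem relEuler_eq_of_homeomorph {A : Set X} {B : Set Y'} (e : X ≃ₜ Y') (he : Set.MapsTo e A B)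
    (he' : Set.MapsTo e.symm B A) : relEuler R M X A = relEuler R M Y' B :=
  eulerChar_congr_of_linearEquiv fun k => relativeSingularHomology.xEquiv R M e he he' k

/-- Equal subspaces give the same finiteness datum. [folklore] -/
theorem FinRelHomology.congr_set {A A' : Set X} (hAA' : A = A') {N : ℕ} (h : FinRelHomology R M X A N) :
    FinRelHomology R M X A' N := by
  subst hAA'; exact h

/-- Equal subspaces give the same Euler characteristic. [folklore] -/
theorem relEuler_congr_set {A A' : Set X} (hAA' : A = A') :
    relEuler R M X A = relEuler R M X A' := by
  subst hAA'; rfl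

/-- A pair all of whose relative homology vanishes has finitely generated homology bounded by
`0`. [folklore] -/
theorem FinRelHomology.of_isZero {A : Set X} (h : ∀ k, IsZero (relativeSingularHomology R M X A k)) :
    FinRelHomology R M X A 0 :=
  FinRelHomology.mk' (fun k hk => absurd hk (Nat.not_lt_zero k)) fun k _ => h k

/-- `H_•(X, X) = 0`: the pair `(X, univ)` is bounded by `0`. [cite: HatcherAT2002, §2.1 (Hₙ(X, X) = 0)] -/
theorem FinRelHomology.univ : FinRelHomology R M X Set.univ 0 :=
  .of_isZero fun k => isZero_relativeSingularHomology_univ R M k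

/-- `H_•(A, A) = 0` for the pair `(A, A ↓∩ A)` realised on `↥A`. [cite: HatcherAT2002, §2.1 (Hₙ(X, X) = 0)] -/
theorem FinRelHomology.preimage_self (A : Set X) :
    FinRelHomology R M (↥A) (Subtype.val ⁻¹' A) 0 :=
  .of_isZero fun k => relativeSingularHomology.isZero_preimage_self R M A k

/-- `χ(A, A) = 0` for the pair `(A, A ↓∩ A)` realised on `↥A`. [cite: HatcherAT2002, §2.1 (Hₙ(X, X) = 0)] -/
theorem relEuler_preimage_self [Nontrivial R] (A : Set X) :
    relEuler R M (↥A) (Subtype.val ⁻¹' A) = 0 :=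
  relEuler_eq_zero_of_isZero fun k => relativeSingularHomology.isZero_preimage_self R M A k

/-- On an empty space every pair is bounded by `0`. [folklore] -/
theorem FinRelHomology.of_isEmpty [IsEmpty X] (A : Set X) : FinRelHomology R M X A 0 := by
  have hA : A = Set.univ := Set.eq_univ_of_forall fun x => isEmptyElim x
  rw [hA]
  exact .univ

/-- `rank H_k(X, ∅) = rank H_k(X)` (Hatcher 2002, §2.1: `Hₙ(X, ∅) = Hₙ(X)`). [cite: HatcherAT2002, §2.1 (Hₙ(X, ∅) = Hₙ(X))] -/
theorem finrank_relativeSingularHomology_empty (k : ℕ) :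
    Module.finrank R (relativeSingularHomology R M X ∅ k) =
      Module.finrank R (singularHomology R M X k) :=
  (LinearEquiv.finrank_eq (relativeSingularHomology.emptyIso R M X k).toLinearEquiv).symm

/-- `χ(X, ∅) = χ(X)` is the Euler characteristic of the absolute singular homology (Hatcher
2002, §2.2 p. 146), as Mathlib's `GradedObject.eulerChar`. [cite: HatcherAT2002, §2.2, p. 146 (Euler characteristic)] -/
theorem relEuler_empty :
    relEuler R M X ∅ = GradedObject.eulerChar (ComplexShape.down ℕ) (fun k => singularHomology R M X k) :=
  (eulerChar_congr_of_linearEquiv fun k => (relativeSingularHomology.emptyIso R M X k).toLinearEquiv).symm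

/-- Under `FinRelHomology R M X ∅ N`: `χ(X) = Σ_{k<N} (-1)^k rank H_k(X)` — the absolute Euler
characteristic as a finite sum (Hatcher 2002, §2.2 p. 146). [cite: HatcherAT2002, §2.2, p. 146 (Euler characteristic)] -/
theorem FinRelHomology.relEuler_empty_eq_sum [Nontrivial R] {N : ℕ} (h : FinRelHomology R M X ∅ N) :
    relEuler R M X ∅ =
      ∑ k ∈ Finset.range N, (-1 : ℤ) ^ k * (Module.finrank R (singularHomology R M X k) : ℤ) := by
  simp only [h.relEuler_eq_sum, finrank_relativeSingularHomology_empty]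

/-- From `FinRelHomology R M X ∅ N`: every `H_k(X)` is finitely generated. [cite: HatcherAT2002, §2.1 (Hₙ(X, ∅) = Hₙ(X))] -/
theorem FinRelHomology.finite_singularHomology {N : ℕ} (h : FinRelHomology R M X ∅ N) (k : ℕ) :
    Module.Finite R (singularHomology R M X k) := by
  haveI := h.finite k
  exact Module.Finite.equiv (relativeSingularHomology.emptyIso R M X k).toLinearEquiv.symm

/-- From `FinRelHomology R M X ∅ N`: `H_k(X) = 0` for `k ≥ N`. [cite: HatcherAT2002, §2.1 (Hₙ(X, ∅) = Hₙ(X))] -/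
theorem FinRelHomology.isZero_singularHomology {N : ℕ} (h : FinRelHomology R M X ∅ N) (k : ℕ)
    (hk : N ≤ k) : IsZero (singularHomology R M X k) :=
  (h.isZero k hk).of_iso (relativeSingularHomology.emptyIso R M X k)

/-- `FinRelHomology R M X ∅ N` from the absolute homology. [cite: HatcherAT2002, §2.1 (Hₙ(X, ∅) = Hₙ(X))] -/
theorem FinRelHomology.empty_of_absolute {N : ℕ} (hfin : ∀ k, Module.Finite R (singularHomology R M X k))
    (hzero : ∀ k, N ≤ k → IsZero (singularHomology R M X k)) : FinRelHomology R M X ∅ N :=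
  ⟨fun k => by
    haveI := hfin k
    exact Module.Finite.equiv (relativeSingularHomology.emptyIso R M X k).toLinearEquiv,
   fun k hk => (hzero k hk).of_iso (relativeSingularHomology.emptyIso R M X k).symm⟩

/-! ### The triple `B ⊆ A ⊆ X` -/

/-- In degree `0` the map `H₀(X, B) ⟶ H₀(X, A)` of the triple is onto (the long exact sequence
ends with `H₀(X, B) → H₀(X, A) → 0`; the quotient map of chain complexes is an epimorphism and
degree `0` has no outgoing differential). [cite: HatcherAT2002, §2.1, p. 118 (exact sequence of a triple)] -/
theorem relativeSingularHomology.epi_map_id_zero {A B : Set X} (h : B ⊆ A) :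
    Epi (relativeSingularHomology.map R M (ContinuousMap.id X) (mapsTo_id_of_subset h) 0) := by
  haveI : Epi (relativeSingularChainComplex.triple R M h).g :=
    (relativeSingularChainComplex.shortExact_triple R M h).epi_g
  haveI : Epi ((relativeSingularChainComplex.map R M (ContinuousMap.id X)
      (mapsTo_id_of_subset h)).f 0) :=
    inferInstanceAs (Epi ((relativeSingularChainComplex.triple R M h).g.f 0))
  exact HomologicalComplex.epi_homologyMap_of_epi_of_not_rel _ 0 (fun j hj => by
    simp only [ComplexShape.down_Rel] at hj; omega)

variable (R M) in
/-- **The long exact sequence of the triple `B ⊆ A ⊆ X` as a `GradedLES`**: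
`A k = H_k(A, B)` (realised on `↥A`), `B k = H_k(X, B)`, `C k = H_k(X, A)` (Hatcher 2002,
§2.1, p. 118; exactness is the tree's `relativeSingularHomology.triple_exact₁/₂/₃`).
[cite: HatcherAT2002, §2.1, p. 118 (exact sequence of a triple)] -/
def GradedLES.ofTriple {A B : Set X} (h : B ⊆ A) : GradedLES.{v, max u v} R where
  A k := relativeSingularHomology R M (↥A) (Subtype.val ⁻¹' B) k
  B k := relativeSingularHomology R M X B k
  C k := relativeSingularHomology R M X A k
  i k := relativeSingularHomology.map R M (⟨Subtype.val, continuous_subtype_val⟩ : C(↥A, X))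
    (mapsTo_val_preimage A B) k
  j k := relativeSingularHomology.map R M (ContinuousMap.id X) (mapsTo_id_of_subset h) k
  d k := relativeSingularHomology.tripleδ R M X A B k
  d_i k := relativeSingularHomology.tripleδ_comp_map R M h k
  i_j k := relativeSingularHomology.map_val_comp_map_id R M h k
  j_d k := relativeSingularHomology.map_comp_tripleδ R M h k
  exact₁ k := relativeSingularHomology.triple_exact₁ R M h k
  exact₂ k := relativeSingularHomology.triple_exact₂ R M h k
  exact₃ k := relativeSingularHomology.triple_exact₃ R M h k
  epi_j_zero := relativeSingularHomology.epi_map_id_zero h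

variable [IsNoetherianRing R] [HasRankNullity.{max u v} R]

/-- **Two out of three for a triple, middle term, with `χ(X, B) = χ(A, B) + χ(X, A)`**
(Hatcher 2002, §2.1 p. 118 and §2.2 Thm. 2.44; Spanier 1966, Ch. 4 §3): if `H_•(A, B)` and
`H_•(X, A)` are finitely generated and vanish from degree `N` on, then so does `H_•(X, B)`, and
the Euler characteristics add. [cite: HatcherAT2002, §2.1 p. 118, §2.2 Thm. 2.44] -/
theorem FinRelHomology.triple_mid {A B : Set X} (h : B ⊆ A) {N : ℕ}
    (hAB : FinRelHomology R M (↥A) (Subtype.val ⁻¹' B) N) (hXA : FinRelHomology R M X A N) :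
    FinRelHomology R M X B N ∧
      relEuler R M X B = relEuler R M (↥A) (Subtype.val ⁻¹' B) + relEuler R M X A := by
  haveI : Nontrivial R := nontrivial_of_hasRankNullity.{max u v} R
  have hfinB : ∀ k, Module.Finite R (relativeSingularHomology R M X B k) := fun k =>
    (GradedLES.ofTriple R M h).finite_B k (hAB.finite k) (hXA.finite k)
  have hzeroB : ∀ k, N ≤ k → IsZero (relativeSingularHomology R M X B k) := fun k hk =>
    (GradedLES.ofTriple R M h).isZero_B k (hAB.isZero k hk) (hXA.isZero k hk)
  have hXB : FinRelHomology R M X B N := ⟨hfinB, hzeroB⟩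
  refine ⟨hXB, ?_⟩
  have key := (GradedLES.ofTriple R M h).eulerSum_rel N (fun k _ => hAB.finite k)
    (fun k _ => hfinB k) (fun k _ => hXA.finite k) (hXA.isZero N le_rfl)
  rw [hXB.relEuler_eq_eulerSum, hAB.relEuler_eq_eulerSum, hXA.relEuler_eq_eulerSum]
  change eulerSum R (GradedLES.ofTriple R M h).B N =
    eulerSum R (GradedLES.ofTriple R M h).A N + eulerSum R (GradedLES.ofTriple R M h).C N
  linarith

/-- **Two out of three for a triple, first term**: if `H_•(X, B)` and `H_•(X, A)` are finitely
generated and vanish from degree `N` on, then so does `H_•(A, B)`, and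
`χ(X, B) = χ(A, B) + χ(X, A)`. [cite: HatcherAT2002, §2.1 p. 118, §2.2 Thm. 2.44] -/
theorem FinRelHomology.triple_left {A B : Set X} (h : B ⊆ A) {N : ℕ}
    (hXB : FinRelHomology R M X B N) (hXA : FinRelHomology R M X A N) :
    FinRelHomology R M (↥A) (Subtype.val ⁻¹' B) N ∧
      relEuler R M X B = relEuler R M (↥A) (Subtype.val ⁻¹' B) + relEuler R M X A := by
  haveI : Nontrivial R := nontrivial_of_hasRankNullity.{max u v} R
  have hfinA : ∀ k, Module.Finite R (relativeSingularHomology R M (↥A) (Subtype.val ⁻¹' B) k) :=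
    fun k => (GradedLES.ofTriple R M h).finite_A k (hXA.finite (k + 1)) (hXB.finite k)
  have hzeroA : ∀ k, N ≤ k → IsZero (relativeSingularHomology R M (↥A) (Subtype.val ⁻¹' B) k) :=
    fun k hk => (GradedLES.ofTriple R M h).isZero_A k (hXA.isZero (k + 1) (by omega))
      (hXB.isZero k hk)
  have hAB : FinRelHomology R M (↥A) (Subtype.val ⁻¹' B) N := ⟨hfinA, hzeroA⟩
  refine ⟨hAB, ?_⟩
  have key := (GradedLES.ofTriple R M h).eulerSum_rel N (fun k _ => hfinA k)
    (fun k _ => hXB.finite k) (fun k _ => hXA.finite k) (hXA.isZero N le_rfl)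
  rw [hXB.relEuler_eq_eulerSum, hAB.relEuler_eq_eulerSum, hXA.relEuler_eq_eulerSum]
  change eulerSum R (GradedLES.ofTriple R M h).B N =
    eulerSum R (GradedLES.ofTriple R M h).A N + eulerSum R (GradedLES.ofTriple R M h).C N
  linarith

/-- **Two out of three for a triple, last term**: if `H_•(A, B)` and `H_•(X, B)` are finitely
generated and vanish from degree `N` on, then `H_•(X, A)` is finitely generated and vanishes
from degree `N + 1` on, and `χ(X, B) = χ(A, B) + χ(X, A)`.
[cite: HatcherAT2002, §2.1 p. 118, §2.2 Thm. 2.44] -/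
theorem FinRelHomology.triple_right {A B : Set X} (h : B ⊆ A) {N : ℕ}
    (hAB : FinRelHomology R M (↥A) (Subtype.val ⁻¹' B) N) (hXB : FinRelHomology R M X B N) :
    FinRelHomology R M X A (N + 1) ∧
      relEuler R M X B = relEuler R M (↥A) (Subtype.val ⁻¹' B) + relEuler R M X A := by
  haveI : Nontrivial R := nontrivial_of_hasRankNullity.{max u v} R
  have hfinC : ∀ k, Module.Finite R (relativeSingularHomology R M X A k) := fun k => by
    cases k with
    | zero => exact (GradedLES.ofTriple R M h).finite_C_zero (hXB.finite 0)
    | succ k => exact (GradedLES.ofTriple R M h).finite_C_succ k (hXB.finite (k + 1)) (hAB.finite k)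
  have hzeroC : ∀ k, N + 1 ≤ k → IsZero (relativeSingularHomology R M X A k) := fun k hk => by
    cases k with
    | zero => omega
    | succ k =>
      exact (GradedLES.ofTriple R M h).isZero_C_succ k (hXB.isZero (k + 1) (by omega))
        (hAB.isZero k (by omega))
  have hXA : FinRelHomology R M X A (N + 1) := ⟨hfinC, hzeroC⟩
  refine ⟨hXA, ?_⟩
  have key := (GradedLES.ofTriple R M h).eulerSum_rel (N + 1) (fun k _ => hAB.finite k)
    (fun k _ => hXB.finite k) (fun k _ => hfinC k) (hzeroC (N + 1) le_rfl)
  rw [(hXB.mono (Nat.le_succ N)).relEuler_eq_eulerSum,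
    (hAB.mono (Nat.le_succ N)).relEuler_eq_eulerSum, hXA.relEuler_eq_eulerSum]
  change eulerSum R (GradedLES.ofTriple R M h).B (N + 1) =
    eulerSum R (GradedLES.ofTriple R M h).A (N + 1) + eulerSum R (GradedLES.ofTriple R M h).C (N + 1)
  linarith

end Pairs

end Literature.AlgebraicTopology.SingularHomology
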